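import Summits.AtomisticToContinuum.HydrodynamicLimit.Theses.AntiMazurCoboundaries
import Summits.AtomisticToContinuum.HydrodynamicLimit.Theorems.CorrectorPressureDecay.Negative.MazurFloor

/-!
# `CorrectorPressureDecay` — negative knowledge (f): the kill criterion as a theorem

Support file for crux `stmt-AtomisticToContinuum-14135` (`AntiMazurCoboundaries.CorrectorPressureDecay`, "X"),
written by the standing disprover (cdisprove seat, cycle 2). The HYPOTHESES of
`correctorPressureDecay_false_of_chargedInvariantEvents` (stated inline, deliberately NOT as a named `def … : Prop`,
so that no fact/construction item is filed for a believed-false premise) package what a refutation of X must exhibit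
through the invariant-event Mazur floor (`mul_exp_average_le_setIntegral_exp_sub_coboundary`): at zero drift, for σ arbitrarily small, for EVERY amplitude κ an admissible `(φ, g)` and a tolerance δ such that for
infinitely many `N` some flow `Φ` has a flow-invariant event `A` with
`G_N(A) · exp(G_N(A)⁻¹ ∫_A 2F dG_N) > e^{δ(N+1)}` — an extensive LD-Drude weight carried by an exactly invariant
structure. The conclusion `¬ CorrectorPressureDecay` holds whatever the lag, the corrector and the cost scale (the cost
clause is not used).

Status of the hypothesis: we believe it is FALSE for 3-d hard spheres at small density — every
`(P,E)`-measurable invariant event is beaten by the shell rate at small κ (the `∃κ` clause), and no invariant structure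
of `N+1` hard spheres on `𝕋³` beyond functions of `(P, E)` is known (Sinai–Simányi ergodicity programme) — so it is
not a wanted construction. The theorem records the logical kill channel; `Negative/AllAmplitudes.lean` is its
instance `A = {E ≤ (N+1)η/2}` at LARGE κ.
All `[folklore]`.
-/

noncomputable section

open MeasureTheory ProbabilityTheory Set Filter Topology
open scoped ENNReal

namespace Summit.AtomisticToContinuum.HydrodynamicLimit.Theorems.CorrectorPressureDecayNegative.KillCriterion

open Literature.MathematicalPhysics.KineticTheory (T3 V3 hsDiameter localGibbsLaw localGibbsMeasure
  localGibbsProfile localGibbsLaw_eq isProbabilityMeasure_localGibbsLaw)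
open Literature.Analysis.FluidPDE (HardSphereFlow Config)
open Summit.AtomisticToContinuum.HydrodynamicLimit.Theses.AntiMazurCoboundaries (CorrectorPressureDecay)

/-- Hard-sphere flows of `N + 1` spheres of reduced diameter `σ` on `𝕋³` (the crux's `Φ`). -/
abbrev Flow (σ : ℝ) (N : ℕ) : Type :=
  HardSphereFlow (Literature.Analysis.FluidPDE.Torus.geometry (Fin 3)) (hsDiameter σ N) (N + 1)

/-- Phase space of `N + 1` spheres on `𝕋³`. -/
abbrev Phase (N : ℕ) : Type := Config (N + 1) (Fin 3) T3



/-- **Charged invariant events refute X** (for every lag, corrector and cost scale): the invariant-event floor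
`mul_exp_average_le_setIntegral_exp_sub_coboundary` bounds the defect integral over `A` from below by
`G_N(A) e^{avg_A 2F} > e^{δ(N+1)}`. [folklore] -/
theorem correctorPressureDecay_false_of_chargedInvariantEvents {a θ : ℝ} (ha : 0 < a) (hθ : 0 < θ)
    (Hσ : ∀ σ₀ : ℝ, 0 < σ₀ → ∃ σ : ℝ, 0 < σ ∧ σ < σ₀ ∧
      ∀ κ : ℝ, 0 < κ → ∃ (φ : T3 → ℝ) (g : V3 → ℝ), Continuous φ ∧ Continuous g ∧ (∀ x, |φ x| ≤ 1) ∧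
        (∀ v, |g v| ≤ κ) ∧
        (∀ (c₀ c₂ : ℝ) (b : V3), ∫ v, g v * (c₀ + inner ℝ b v + c₂ * ‖v‖ ^ 2) ∂stdGaussian V3 = 0) ∧
        ∃ δ : ℝ, 0 < δ ∧ ∀ N₀ : ℕ, ∃ N : ℕ, N₀ ≤ N ∧ ∃ Φ : Flow σ N, ∃ A : Set (Phase N), MeasurableSet A ∧
          (∀ t : ℝ, 0 < t → Φ.flow t ⁻¹' A = A) ∧
          localGibbsLaw σ (fun _ => a) (fun _ => 0) (fun _ => θ) N Φ A ≠ 0 ∧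
          Real.exp (δ * (N + 1)) <
            (localGibbsLaw σ (fun _ => a) (fun _ => 0) (fun _ => θ) N Φ A).toReal *
              Real.exp ((localGibbsLaw σ (fun _ => a) (fun _ => 0) (fun _ => θ) N Φ A).toReal⁻¹ *
                ∫ z in A, 2 * ∑ i, φ (z i).1 * g ((Real.sqrt θ)⁻¹ • ((z i).2 - 0))
                  ∂(localGibbsLaw σ (fun _ => a) (fun _ => 0) (fun _ => θ) N Φ))) :
    ¬ CorrectorPressureDecay := by
  intro hX
  obtain ⟨σ₀, hσ₀, HX⟩ := hX a θ 0 ha hθ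
  obtain ⟨σ, hσ, hσlt, Hκ⟩ := Hσ σ₀ hσ₀
  obtain ⟨hprob, κ, hκ, hmain⟩ := HX σ hσ hσlt
  obtain ⟨φ, g, hφ, hg, hφ1, hgκ, horth, δ, hδ, HN⟩ := Hκ κ hκ
  obtain ⟨τ₀, _hτ₀, N₀, hN⟩ := hmain φ g hφ hg hφ1 hgκ horth δ hδ
  obtain ⟨N, hN₀, Φ, A, hA, hinvA, hGA, hbig⟩ := HN N₀
  obtain ⟨lag, hlag, W, hWm, ⟨CW, hW⟩, h1, _h2⟩ := hN N hN₀ Φ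
  haveI := hprob N Φ
  set G := localGibbsLaw σ (fun _ => a) (fun _ => (0 : V3)) (fun _ => θ) N Φ with hGdef
  set F : Phase N → ℝ := fun z => 2 * ∑ i, φ (z i).1 * g ((Real.sqrt θ)⁻¹ • ((z i).2 - 0)) with hF
  have hFm : Measurable F := by
    have : Continuous F := by
      simp only [hF]
      fun_prop
    exact this.measurable
  have hκ0 : 0 ≤ κ := hκ.le
  have hFb : ∀ z, |F z| ≤ 2 * ∑ _i : Fin (N + 1), κ := by
    intro z
    rw [hF, abs_mul, abs_two]
    refine mul_le_mul_of_nonneg_left ((Finset.abs_sum_le_sum_abs _ _).trans (Finset.sum_le_sum fun i _ => ?_))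
      two_pos.le
    rw [abs_mul]
    calc |φ (z i).1| * |g ((Real.sqrt θ)⁻¹ • ((z i).2 - 0))| ≤ 1 * κ :=
          mul_le_mul (hφ1 _) (hgκ _) (abs_nonneg _) zero_le_one
      _ = κ := one_mul κ
  have hT : MeasurePreserving (Φ.flow lag) G G := measurePreserving_flow_localGibbsLaw a θ N Φ lag
  have hfloor := mul_exp_average_le_setIntegral_exp_sub_coboundary hT hA (hinvA lag hlag) hGA hFm hWm hFb hW
    (2 * lag⁻¹)
  -- the defect clause, as a Bochner integral of the same integrand
  have hrw1 : ∀ z : Phase N, Real.exp (2 * ((∑ i, φ (z i).1 * g ((Real.sqrt θ)⁻¹ • ((z i).2 - 0))) -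
      lag⁻¹ * (W (Φ.flow lag z) - W z))) = Real.exp (F z - 2 * lag⁻¹ * (W (Φ.flow lag z) - W z)) := by
    intro z
    simp only [hF]
    congr 1
    ring
  simp_rw [hrw1] at h1
  have hYm : Measurable fun z => F z - 2 * lag⁻¹ * (W (Φ.flow lag z) - W z) :=
    hFm.sub (measurable_const.mul ((hWm.comp (Φ.measurable_flow lag)).sub hWm))
  have hYb : ∀ z, |F z - 2 * lag⁻¹ * (W (Φ.flow lag z) - W z)| ≤ (2 * ∑ _i : Fin (N + 1), κ) +
      |2 * lag⁻¹| * (CW + CW) := by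
    intro z
    calc |F z - 2 * lag⁻¹ * (W (Φ.flow lag z) - W z)| ≤ |F z| + |2 * lag⁻¹ * (W (Φ.flow lag z) - W z)| :=
          abs_sub _ _
      _ = |F z| + |2 * lag⁻¹| * |W (Φ.flow lag z) - W z| := by
          rw [abs_mul (2 * lag⁻¹) (W (Φ.flow lag z) - W z)]
      _ ≤ _ := by
          gcongr
          · exact hFb z
          · exact (abs_sub _ _).trans (add_le_add (hW _) (hW _))
  have hYint : Integrable (fun z => Real.exp (F z - 2 * lag⁻¹ * (W (Φ.flow lag z) - W z))) G :=
    integrable_exp_of_abs_le hYm hYb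
  have hI1 : ∫ z, Real.exp (F z - 2 * lag⁻¹ * (W (Φ.flow lag z) - W z)) ∂G ≤ Real.exp (δ * (N + 1)) := by
    rw [← ofReal_integral_eq_lintegral_ofReal hYint (ae_of_all _ fun _ => (Real.exp_pos _).le),
      ENNReal.ofReal_le_ofReal_iff (Real.exp_pos _).le] at h1
    exact h1
  have hset : ∫ z in A, Real.exp (F z - 2 * lag⁻¹ * (W (Φ.flow lag z) - W z)) ∂G ≤
      ∫ z, Real.exp (F z - 2 * lag⁻¹ * (W (Φ.flow lag z) - W z)) ∂G :=
    setIntegral_le_integral hYint (ae_of_all _ fun _ => (Real.exp_pos _).le)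
  have := (hfloor.trans hset).trans hI1
  exact absurd (hbig.trans_le this) (lt_irrefl _)


end Summit.AtomisticToContinuum.HydrodynamicLimit.Theorems.CorrectorPressureDecayNegative.KillCriterion

end
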